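import Mathlib.Topology.Homotopy.Equiv
import Mathlib.Topology.CompactOpen
import Mathlib.Analysis.Normed.Module.Basic
import HarnessLib

/-!
# Attaching discs to a space: the adjunction space `Z ∪_φ ⊔ᵢ Dᵈ`

Topic `Literature/AlgebraicTopology/Homotopy` (Hatcher, *Algebraic Topology* (2002), Ch. 0,
p. 7: "attaching cells"; Milnor, *Lectures on the h-cobordism theorem* (1965), Thm. 3.14 and its
Remark: the level `V` with the left-hand discs attached).  Neither Mathlib (pinned) nor the tree
has adjunction spaces of maps (`lean search 'adjunction space|AttachCell|DiscAttach'`: nothing;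
the tree's `IsAttachedCell` of `SingularHomology/CellAttachmentHomology.lean` is the *predicate*
"a closed cell embedded in an ambient space meets `Y` in its boundary sphere", and
`MappingCylinder.lean` is the model for the construction used here).  Everything is PROVED
(definitions with their basic properties; no named facts):

* `DiscAttach φ` — for a space `Z`, an index type `ι`, a dimension `d` and attaching maps
  `φᵢ : ∂Dᵈ → Z` (`Dᵈ` the closed unit ball of `ℝᵈ = Fin d → ℝ` in the sup norm, Mathlib's
  cell model `Topology.RelCWComplex`), the quotient of `Z ⊔ ⊔ᵢ Dᵈ` by `x ∼ φᵢ x` (`x ∈ ∂Dᵈ_i`),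
  with the quotient topology; the structure maps `inZ : Z → Z ∪_φ ⊔ᵢ Dᵈ` (injective) and
  `inD i : Dᵈ → Z ∪_φ ⊔ᵢ Dᵈ` (injective on the open ball, `inD i x = inZ (φᵢ x)` on the sphere);
* the universal property `DiscAttach.desc` (maps out of the attachment space are pairs of
  compatible maps) and `continuous_prod_of_continuous_comp` (homotopies: `mk × 𝟙_I` is a
  quotient map);
* `DiscAttach.instCompactSpace`, `DiscAttach.instT2Space`: attaching finitely many discs to a
  compact (Hausdorff) space gives a compact (Hausdorff) space — through the general
  `t2Space_quotient_of_isClosed` (a quotient of a compact Hausdorff space by a closed equivalence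
  relation is Hausdorff) and the closedness of the gluing relation `isClosed_rel`;
* `DiscAttach.homeomorphUnion` — **embedded discs**: if `Y ⊆ X` is compact (`X` Hausdorff) and
  `Φᵢ : Dᵈ → X` are finitely many continuous injections with pairwise disjoint images meeting
  `Y` exactly in their boundary spheres (`Φᵢ x ∈ Y ↔ ‖x‖ = 1`), then
  `Y ∪ ⋃ᵢ Φᵢ(Dᵈ) ≃ₜ Y ∪_φ ⊔ᵢ Dᵈ` with `φᵢ = Φᵢ|∂Dᵈ` — Milnor's `V ∪ D₁ ∪ ⋯ ∪ D_k`.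

This is the first piece of the topological half of the tree's discharge of Sha's theorem
(`Literature/Geometry/Riemannian/PConvexDomainHomotopyType.lean`): a compact manifold with
boundary carrying an adapted Morse function with critical points of index `≤ k` has the
homotopy type of a finite CW complex of dimension `≤ k` (Milnor 1963, Thm. 3.5), assembled from
Milnor's Thm. 3.14 (tree) through the homotopy invariance of disc attachment and a CW structure
on `K ∪_ψ ⊔ᵢ Dᵈ`.

## Design notes

* As in `MappingCylinder.lean` the gluing relation is the kernel of a normal-form function
  `DiscAttach.key` (sphere points renamed by their attaching images), so `mk p = mk q` iff the
  normal forms agree and no inductive closure is needed.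
* The discs are indexed by a bare type `ι` through a `Σ`-type (no topology on `ι` required);
  compactness and the Hausdorff property are proved for `Finite ι` and compact `Z`, which is
  all the Morse-theoretic application needs.
* Universe: `Z : Type u`, `ι : Type`, `DiscAttach φ : Type u`.

## References

* A. Hatcher, *Algebraic Topology*, CUP (2002), Ch. 0, pp. 7, 14–16 (attaching cells, Prop. 0.16
  ff.). [HatcherAT2002]
* J. Milnor, *Lectures on the h-cobordism theorem*, Princeton (1965), Thm. 3.14 and Remark
  (PDF pp. 19–21). [MilnorHCobordism1965]
-/

noncomputable section

open Set Function Metric Topology unitInterval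

universe u

namespace Literature.AlgebraicTopology.Homotopy

/-! ### A quotient of a compact Hausdorff space by a closed equivalence relation is Hausdorff -/

section QuotientT2

variable {P : Type*} [TopologicalSpace P]

/-- On a compact Hausdorff space, the quotient map of a closed equivalence relation is a closed map
(the saturation of a closed set `C` is the projection of the compact set `R ∩ (C × P)`). [folklore] -/
theorem isClosedMap_quotient_mk_of_isClosed [CompactSpace P] [T2Space P] (s : Setoid P)
    (hR : IsClosed {pq : P × P | s pq.1 pq.2}) :
    IsClosedMap (Quotient.mk s : P → Quotient s) := by
  intro C hC
  -- the saturation of `C` is the projection of the closed set `R ∩ (C × P)`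
  have hsat : (Quotient.mk s) ⁻¹' ((Quotient.mk s) '' C) = Prod.snd '' ({pq : P × P | s pq.1 pq.2} ∩ C ×ˢ univ) := by
    ext q
    simp only [mem_preimage, mem_image, mem_inter_iff, mem_setOf_eq, mem_prod, mem_univ, and_true,
      Prod.exists, exists_eq_right]
    constructor
    · rintro ⟨p, hp, hpq⟩
      exact ⟨p, Quotient.exact hpq, hp⟩
    · rintro ⟨p, hpq, hp⟩
      exact ⟨p, hp, Quotient.sound hpq⟩
  have hclosed : IsClosed ((Quotient.mk s) ⁻¹' ((Quotient.mk s) '' C)) := by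
    rw [hsat]
    exact ((hR.inter (hC.prod isClosed_univ)).isCompact.image continuous_snd).isClosed
  exact isQuotientMap_quotient_mk'.isClosed_preimage.1 hclosed

/-- **A quotient of a compact Hausdorff space by a closed equivalence relation is Hausdorff**: the
quotient map is closed, fibres are compact, and disjoint compact sets have disjoint saturated open
neighbourhoods. [folklore] -/
theorem t2Space_quotient_of_isClosed [CompactSpace P] [T2Space P] (s : Setoid P)
    (hR : IsClosed {pq : P × P | s pq.1 pq.2}) : T2Space (Quotient s) := by
  have hcl := isClosedMap_quotient_mk_of_isClosed s hR
  have hfib : ∀ y : Quotient s, IsClosed ((Quotient.mk s) ⁻¹' {y}) := fun y => by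
    obtain ⟨p, rfl⟩ := Quotient.mk_surjective y
    have : ({Quotient.mk s p} : Set (Quotient s)) = (Quotient.mk s) '' {p} := by simp
    rw [this]
    exact (hcl _ isClosed_singleton).preimage continuous_quotient_mk'
  refine (t2Space_iff (Quotient s)).2 fun y₁ y₂ hne => ?_
  obtain ⟨U₁, U₂, hU₁, hU₂, h₁, h₂, hdisj⟩ := SeparatedNhds.of_isCompact_isCompact_isClosed
    (hfib y₁).isCompact (hfib y₂).isCompact (hfib y₂)
    (Set.disjoint_left.2 fun p hp hp' => hne (hp.symm.trans hp'))
  -- the open sets of points whose fibre lies in `Uₖ`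
  refine ⟨((Quotient.mk s) '' U₁ᶜ)ᶜ, ((Quotient.mk s) '' U₂ᶜ)ᶜ,
    (hcl _ hU₁.isClosed_compl).isOpen_compl, (hcl _ hU₂.isClosed_compl).isOpen_compl, ?_, ?_, ?_⟩
  · rintro ⟨p, hp, rfl⟩
    exact hp (h₁ (mem_singleton _))
  · rintro ⟨p, hp, rfl⟩
    exact hp (h₂ (mem_singleton _))
  · refine Set.disjoint_left.2 fun y hy₁ hy₂ => ?_
    obtain ⟨p, rfl⟩ := Quotient.mk_surjective y
    have hp₁ : p ∈ U₁ := by_contra fun h => hy₁ ⟨p, h, rfl⟩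
    have hp₂ : p ∈ U₂ := by_contra fun h => hy₂ ⟨p, h, rfl⟩
    exact Set.disjoint_left.1 hdisj hp₁ hp₂

end QuotientT2

/-- Local notation: the model disc `D^d` (closed unit ball of `ℝᵈ` in the sup norm, Mathlib's
cell model) and its boundary sphere `S^{d-1}`, as sets. -/
local notation "𝔻 " d:arg => Metric.closedBall (0 : Fin d → ℝ) 1
local notation "𝕊 " d:arg => Metric.sphere (0 : Fin d → ℝ) 1

variable {Z : Type u} [TopologicalSpace Z] {ι : Type} {d : ℕ}

namespace DiscAttach

/-- The disjoint union `Z ⊔ ⊔ᵢ D^d` before gluing. [folklore] -/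
abbrev Pre (Z : Type u) (ι : Type) (d : ℕ) : Type u := Z ⊕ (Σ _ : ι, ↥(𝔻 d))

/-- A point of a model disc lies on the boundary sphere. [folklore] -/
def OnSphere (x : ↥(𝔻 d)) : Prop := ‖(x : Fin d → ℝ)‖ = 1

/-- Decidability of being on the sphere (classical). [folklore] -/
instance (x : ↥(𝔻 d)) : Decidable (OnSphere x) := by unfold OnSphere; infer_instance

/-- A boundary point of the disc, as a point of the model sphere. [folklore] -/
def toSphere (x : ↥(𝔻 d)) (hx : OnSphere x) : ↥(𝕊 d) := ⟨x, by simpa [OnSphere] using hx⟩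

/-- Coercion of `toSphere`. [folklore] -/
@[simp] theorem coe_toSphere (x : ↥(𝔻 d)) (hx : OnSphere x) : (toSphere x hx : Fin d → ℝ) = x := rfl

/-- A point of the model sphere, as a (boundary) point of the disc. [folklore] -/
def ofSphere (x : ↥(𝕊 d)) : ↥(𝔻 d) := ⟨x, sphere_subset_closedBall x.2⟩

/-- Coercion of `ofSphere`. [folklore] -/
@[simp] theorem coe_ofSphere (x : ↥(𝕊 d)) : (ofSphere x : Fin d → ℝ) = x := rfl

/-- A sphere point is on the sphere. [folklore] -/
theorem onSphere_ofSphere (x : ↥(𝕊 d)) : OnSphere (ofSphere x) := by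
  have := x.2
  rw [mem_sphere_zero_iff_norm] at this
  exact this

/-- `toSphere ∘ ofSphere = id`. [folklore] -/
@[simp] theorem toSphere_ofSphere (x : ↥(𝕊 d)) (h : OnSphere (ofSphere x)) :
    toSphere (ofSphere x) h = x := Subtype.ext rfl

/-- The normal form of a point of `Z ⊔ ⊔ᵢ D^d` under the gluing `(i, x) ∼ φᵢ x` (`‖x‖ = 1`):
boundary points of the discs are renamed by their attaching images, all other points are fixed.
[folklore] -/
def key (φ : ι → C(↥(𝕊 d), Z)) : Pre Z ι d → Pre Z ι d
  | Sum.inl z => Sum.inl z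
  | Sum.inr ⟨i, x⟩ => if hx : OnSphere x then Sum.inl (φ i (toSphere x hx)) else Sum.inr ⟨i, x⟩

variable (φ : ι → C(↥(𝕊 d), Z))

/-- `key` fixes `Z`. [folklore] -/
@[simp] theorem key_inl (z : Z) : key φ (Sum.inl z) = Sum.inl z := rfl

/-- `key` on a boundary point of a disc. [folklore] -/
theorem key_inr_of_onSphere {i : ι} {x : ↥(𝔻 d)} (hx : OnSphere x) :
    key φ (Sum.inr ⟨i, x⟩) = Sum.inl (φ i (toSphere x hx)) := dif_pos hx

/-- `key` on an interior point of a disc. [folklore] -/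
theorem key_inr_of_not_onSphere {i : ι} {x : ↥(𝔻 d)} (hx : ¬ OnSphere x) :
    key φ (Sum.inr ⟨i, x⟩) = Sum.inr ⟨i, x⟩ := dif_neg hx

/-- `key` is idempotent (a normal form). [folklore] -/
theorem key_key (p : Pre Z ι d) : key φ (key φ p) = key φ p := by
  rcases p with z | ⟨i, x⟩
  · rfl
  · by_cases hx : OnSphere x
    · rw [key_inr_of_onSphere φ hx]; rfl
    · rw [key_inr_of_not_onSphere φ hx, key_inr_of_not_onSphere φ hx]

/-- If the normal form is a disc point then the point was that disc point (off the sphere).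
[folklore] -/
theorem eq_of_key_eq_inr {p : Pre Z ι d} {q : Σ _ : ι, ↥(𝔻 d)} (h : key φ p = Sum.inr q) :
    p = Sum.inr q ∧ ¬ OnSphere q.2 := by
  rcases p with z | ⟨i, x⟩
  · simp at h
  · by_cases hx : OnSphere x
    · rw [key_inr_of_onSphere φ hx] at h; simp at h
    · rw [key_inr_of_not_onSphere φ hx] at h
      cases h
      exact ⟨rfl, hx⟩

/-- The gluing relation, as the kernel of the normal form. [folklore] -/
def setoid : Setoid (Pre Z ι d) := Setoid.ker (key φ)

end DiscAttach

/-- **The space `Z ∪_φ ⊔ᵢ D^d` obtained from `Z` by attaching `d`-discs** along the maps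
`φᵢ : S^{d-1} → Z` (Hatcher 2002, Ch. 0, p. 7: attaching cells), the quotient of `Z ⊔ ⊔ᵢ D^d`
by `x ∼ φᵢ(x)` for `x ∈ ∂D^d_i`, with the quotient topology. [folklore] -/
def DiscAttach (φ : ι → C(↥(𝕊 d), Z)) : Type u := Quotient (DiscAttach.setoid φ)

namespace DiscAttach

variable (φ : ι → C(↥(𝕊 d), Z))

/-- The quotient topology. [folklore] -/
instance instTopologicalSpace : TopologicalSpace (DiscAttach φ) :=
  inferInstanceAs (TopologicalSpace (Quotient (DiscAttach.setoid φ)))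

/-- The quotient map. [folklore] -/
def mk : Pre Z ι d → DiscAttach φ := Quotient.mk''

/-- `mk` is a quotient map. [folklore] -/
theorem isQuotientMap_mk : IsQuotientMap (mk φ) := isQuotientMap_quotient_mk'

/-- `mk` is continuous. [folklore] -/
theorem continuous_mk : Continuous (mk φ) := continuous_quotient_mk'

/-- `mk` is surjective. [folklore] -/
theorem mk_surjective : Surjective (mk φ) := Quotient.mk''_surjective

/-- Two points are identified iff they have the same normal form. [folklore] -/
theorem mk_eq_mk_iff {p q : Pre Z ι d} : mk φ p = mk φ q ↔ key φ p = key φ q := Quotient.eq''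

/-- Induction on the attachment space. [folklore] -/
@[elab_as_elim]
theorem ind {P : DiscAttach φ → Prop} (h : ∀ p, P (mk φ p)) (m : DiscAttach φ) : P m :=
  Quotient.inductionOn' m h

/-- Descending a function constant on normal forms. [folklore] -/
def lift {T : Type*} (g : Pre Z ι d → T) (hg : ∀ p, g (key φ p) = g p) : DiscAttach φ → T :=
  Quotient.lift g fun p q (h : key φ p = key φ q) => by rw [← hg p, h, hg q]

/-- `lift` computes on representatives. [folklore] -/
@[simp]
theorem lift_mk {T : Type*} (g : Pre Z ι d → T) (hg : ∀ p, g (key φ p) = g p) (p : Pre Z ι d) :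
    lift φ g hg (mk φ p) = g p := rfl

/-- A lift of a continuous function is continuous. [folklore] -/
theorem continuous_lift {T : Type*} [TopologicalSpace T] (g : Pre Z ι d → T)
    (hg : ∀ p, g (key φ p) = g p) (hc : Continuous g) : Continuous (lift φ g hg) :=
  (isQuotientMap_mk φ).continuous_iff.2 hc

/-! ### The structure maps -/

/-- The inclusion of `Z`. [folklore] -/
def inZ : C(Z, DiscAttach φ) := ⟨fun z => mk φ (Sum.inl z), (continuous_mk φ).comp continuous_inl⟩

/-- `inZ` on points. [folklore] -/
theorem inZ_apply (z : Z) : inZ φ z = mk φ (Sum.inl z) := rfl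

/-- The characteristic map of the `i`-th disc. [folklore] -/
def inD (i : ι) : C(↥(𝔻 d), DiscAttach φ) where
  toFun x := mk φ (Sum.inr ⟨i, x⟩)
  continuous_toFun := by
    have h : Continuous fun x : ↥(𝔻 d) => (Sum.inr ⟨i, x⟩ : Pre Z ι d) :=
      continuous_inr.comp continuous_sigmaMk
    exact (continuous_mk φ).comp h

/-- `inD` on points. [folklore] -/
theorem inD_apply (i : ι) (x : ↥(𝔻 d)) : inD φ i x = mk φ (Sum.inr ⟨i, x⟩) := rfl

/-- The gluing: a boundary point of a disc is its attaching image. [folklore] -/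
theorem inD_of_onSphere (i : ι) {x : ↥(𝔻 d)} (hx : OnSphere x) :
    inD φ i x = inZ φ (φ i (toSphere x hx)) :=
  (mk_eq_mk_iff φ).2 (by rw [key_inr_of_onSphere φ hx, key_inl])

/-- The gluing, for a point of the model sphere: `inD i x = inZ (φᵢ x)`. [folklore] -/
theorem inD_ofSphere (i : ι) (x : ↥(𝕊 d)) : inD φ i (ofSphere x) = inZ φ (φ i x) := by
  rw [inD_of_onSphere φ i (onSphere_ofSphere x), toSphere_ofSphere]

/-- `Z` embeds (set-theoretically). [folklore] -/
theorem inZ_injective : Injective (inZ φ) := fun z z' h => by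
  have := (mk_eq_mk_iff φ).1 h
  simpa using this

/-- Every point is a point of `Z` or an interior point of a disc. [folklore] -/
theorem exists_eq (m : DiscAttach φ) :
    (∃ z, m = inZ φ z) ∨ (∃ (i : ι) (x : ↥(𝔻 d)), ¬ OnSphere x ∧ m = inD φ i x) := by
  induction m using ind φ with
  | h p =>
    rcases p with z | ⟨i, x⟩
    · exact Or.inl ⟨z, rfl⟩
    · by_cases hx : OnSphere x
      · exact Or.inl ⟨_, inD_of_onSphere φ i hx⟩
      · exact Or.inr ⟨i, x, hx, rfl⟩

/-- Two interior disc points are identified only if equal. [folklore] -/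
theorem inD_eq_inD_iff_of_not_onSphere {i j : ι} {x y : ↥(𝔻 d)} (hx : ¬ OnSphere x) :
    inD φ i x = inD φ j y ↔ i = j ∧ HEq x y := by
  constructor
  · intro h
    have h1 := (mk_eq_mk_iff φ).1 h
    rw [key_inr_of_not_onSphere φ hx] at h1
    have h2 := (eq_of_key_eq_inr φ h1.symm).1
    simp only [Sum.inr.injEq] at h2
    obtain ⟨rfl, h3⟩ := Sigma.mk.inj_iff.1 h2
    exact ⟨rfl, h3.symm⟩
  · rintro ⟨rfl, h⟩
    cases h; rfl

/-- An interior disc point is not a point of `Z`. [folklore] -/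
theorem inD_ne_inZ_of_not_onSphere {i : ι} {x : ↥(𝔻 d)} (hx : ¬ OnSphere x) (z : Z) :
    inD φ i x ≠ inZ φ z := fun h => by
  have h1 := (mk_eq_mk_iff φ).1 h
  rw [key_inr_of_not_onSphere φ hx, key_inl] at h1
  cases h1

/-! ### Maps out of `Z ∪_φ ⊔ᵢ D^d` -/

/-- The universal property: a continuous map on `Z` and continuous maps on the discs agreeing
on the boundary spheres define a continuous map on `Z ∪_φ ⊔ᵢ D^d`. [folklore] -/
def desc {T : Type*} [TopologicalSpace T] (g : C(Z, T)) (h : ι → C(↥(𝔻 d), T))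
    (compat : ∀ i (x : ↥(𝕊 d)), h i (ofSphere x) = g (φ i x)) : C(DiscAttach φ, T) where
  toFun := lift φ (Sum.elim g fun q => h q.1 q.2) fun p => by
    rcases p with z | ⟨i, x⟩
    · rfl
    · by_cases hx : OnSphere x
      · rw [key_inr_of_onSphere φ hx]
        simp only [Sum.elim_inl, Sum.elim_inr]
        rw [← compat i (toSphere x hx)]
        rfl
      · rw [key_inr_of_not_onSphere φ hx]
  continuous_toFun := continuous_lift φ _ _
    (g.continuous.sumElim (continuous_sigma fun i => (h i).continuous))

/-- `desc` on `Z`. [folklore] -/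
@[simp]
theorem desc_inZ {T : Type*} [TopologicalSpace T] (g : C(Z, T)) (h : ι → C(↥(𝔻 d), T))
    (compat : ∀ i (x : ↥(𝕊 d)), h i (ofSphere x) = g (φ i x)) (z : Z) :
    desc φ g h compat (inZ φ z) = g z := rfl

/-- `desc` on the discs. [folklore] -/
@[simp]
theorem desc_inD {T : Type*} [TopologicalSpace T] (g : C(Z, T)) (h : ι → C(↥(𝔻 d), T))
    (compat : ∀ i (x : ↥(𝕊 d)), h i (ofSphere x) = g (φ i x)) (i : ι) (x : ↥(𝔻 d)) :
    desc φ g h compat (inD φ i x) = h i x := rfl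

/-- Continuity of a map on `I × (Z ∪_φ ⊔ᵢ D^d)` is checked on `I × Z` and on the `I × D^d`
(`mk × 𝟙_I` is a quotient map, `I` being locally compact). [folklore] -/
theorem continuous_prod_of_continuous_comp {T : Type*} [TopologicalSpace T]
    {F : I × DiscAttach φ → T}
    (hZ : Continuous fun p : I × Z => F (p.1, inZ φ p.2))
    (hD : ∀ i, Continuous fun p : I × ↥(𝔻 d) => F (p.1, inD φ i p.2)) : Continuous F := by
  refine (isQuotientMap_mk φ).continuous_lift_prod_right ?_
  have hF : (fun p : I × Pre Z ι d => F (p.1, mk φ p.2)) =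
      Sum.elim (fun p : I × Z => F (p.1, inZ φ p.2))
        (fun p : I × (Σ _ : ι, ↥(𝔻 d)) => F (p.1, inD φ p.2.1 p.2.2)) ∘ Homeomorph.prodSumDistrib := by
    ext ⟨s, p⟩
    rcases p with z | ⟨i, x⟩ <;> rfl
  rw [hF]
  refine (hZ.sumElim ?_).comp Homeomorph.prodSumDistrib.continuous
  have h2 : (fun p : I × (Σ _ : ι, ↥(𝔻 d)) => F (p.1, inD φ p.2.1 p.2.2)) =
      (fun q : Σ _ : ι, ↥(𝔻 d) × I => F (q.2.2, inD φ q.1 q.2.1)) ∘ Homeomorph.sigmaProdDistrib ∘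
        Prod.swap := by
    ext ⟨s, ⟨i, x⟩⟩; rfl
  rw [h2]
  refine (continuous_sigma fun i => ?_).comp
    (Homeomorph.sigmaProdDistrib.continuous.comp continuous_swap)
  exact (hD i).comp continuous_swap

/-! ### Compactness and the Hausdorff property -/

/-- Attaching finitely many discs to a compact space gives a compact space. [folklore] -/
instance instCompactSpace [CompactSpace Z] [Finite ι] : CompactSpace (DiscAttach φ) := by
  haveI : CompactSpace (↥(𝔻 d)) := isCompact_iff_compactSpace.1 (isCompact_closedBall _ _)
  exact Quotient.compactSpace

/-- The boundary spheres `⊔ᵢ S^{d-1}` mapped into the discs. [folklore] -/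
def sphIncl : (Σ _ : ι, ↥(𝕊 d)) → (Σ _ : ι, ↥(𝔻 d)) := Sigma.map id fun _ => ofSphere

/-- `sphIncl` is continuous. [folklore] -/
theorem continuous_sphIncl : Continuous (sphIncl (ι := ι) (d := d)) :=
  Continuous.sigma_map fun _ => continuous_inclusion sphere_subset_closedBall

/-- `sphIncl` is injective. [folklore] -/
theorem sphIncl_injective : Injective (sphIncl (ι := ι) (d := d)) :=
  Function.Injective.sigma_map injective_id fun _ => inclusion_injective sphere_subset_closedBall

/-- The attaching maps assembled: `⊔ᵢ S^{d-1} → Z`. [folklore] -/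
def sphMap : (Σ _ : ι, ↥(𝕊 d)) → Z := fun q => φ q.1 q.2

/-- `sphMap` is continuous. [folklore] -/
theorem continuous_sphMap : Continuous (sphMap φ) := continuous_sigma fun i => (φ i).continuous

variable {φ} in
/-- The normal form of a disc point is a point of `Z` iff the point is a sphere point, renamed by
its attaching image. [folklore] -/
theorem key_inr_eq_inl_iff {i : ι} {x : ↥(𝔻 d)} {z : Z} :
    key φ (Sum.inr ⟨i, x⟩) = Sum.inl z ↔ ∃ s : ↥(𝕊 d), x = ofSphere s ∧ φ i s = z := by
  constructor
  · intro h
    by_cases hx : OnSphere x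
    · rw [key_inr_of_onSphere φ hx] at h
      refine ⟨toSphere x hx, Subtype.ext rfl, by simpa using h⟩
    · rw [key_inr_of_not_onSphere φ hx] at h; cases h
  · rintro ⟨s, rfl, rfl⟩
    rw [key_inr_of_onSphere φ (onSphere_ofSphere s), toSphere_ofSphere]

/-- The gluing relation is closed (`Z` Hausdorff, finitely many discs). [folklore] -/
theorem isClosed_rel [T2Space Z] [Finite ι] :
    IsClosed {pq : Pre Z ι d × Pre Z ι d | (DiscAttach.setoid φ) pq.1 pq.2} := by
  haveI : CompactSpace (↥(𝕊 d)) := isCompact_iff_compactSpace.1 (isCompact_sphere _ _)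
  set R : Set (Pre Z ι d × Pre Z ι d) := {pq | (DiscAttach.setoid φ) pq.1 pq.2} with hR
  have hRiff : ∀ p q, (p, q) ∈ R ↔ key φ p = key φ q := fun p q => Iff.rfl
  have hjc : Continuous (fun q : (Σ _ : ι, ↥(𝕊 d)) => (Sum.inr (sphIncl q) : Pre Z ι d)) :=
    continuous_inr.comp continuous_sphIncl
  have hΦc : Continuous (sphMap φ) := continuous_sphMap φ
  -- the four closed pieces
  set Δ : Set (Pre Z ι d × Pre Z ι d) := {pq | pq.1 = pq.2} with hΔ
  have hΔc : IsClosed Δ := isClosed_eq continuous_fst continuous_snd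
  set fA : (Σ _ : ι, ↥(𝕊 d)) → Pre Z ι d × Pre Z ι d := fun s =>
    ((Sum.inl (sphMap φ s) : Pre Z ι d), (Sum.inr (sphIncl s) : Pre Z ι d)) with hfA
  have hfAc : Continuous fA := (continuous_inl.comp hΦc).prodMk hjc
  set A : Set (Pre Z ι d × Pre Z ι d) := range fA with hA
  have hAc : IsClosed A := (isCompact_range hfAc).isClosed
  set A' : Set (Pre Z ι d × Pre Z ι d) := range (Prod.swap ∘ fA) with hA'
  have hA'c : IsClosed A' := (isCompact_range (continuous_swap.comp hfAc)).isClosed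
  set fB : (Σ _ : ι, ↥(𝕊 d)) × (Σ _ : ι, ↥(𝕊 d)) → Pre Z ι d × Pre Z ι d := fun ss =>
    ((Sum.inr (sphIncl ss.1) : Pre Z ι d), (Sum.inr (sphIncl ss.2) : Pre Z ι d)) with hfB
  have hfBc : Continuous fB := (hjc.comp continuous_fst).prodMk (hjc.comp continuous_snd)
  set B : Set (Pre Z ι d × Pre Z ι d) := fB '' {ss | sphMap φ ss.1 = sphMap φ ss.2} with hB
  have hBc : IsClosed B :=
    ((isClosed_eq (hΦc.comp continuous_fst) (hΦc.comp continuous_snd)).isCompact.image hfBc).isClosed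
  -- `R` is their union
  have hsub : R ⊆ Δ ∪ A ∪ A' ∪ B := by
    rintro ⟨p, q⟩ h
    rw [hRiff] at h
    rcases p with z | ⟨i, x⟩ <;> rcases q with z' | ⟨j, y⟩
    · left; left; left
      change (Sum.inl z : Pre Z ι d) = Sum.inl z'
      simpa using h
    · have h' : key φ (Sum.inr ⟨j, y⟩) = Sum.inl z := by rw [← h]; rfl
      obtain ⟨s, hy, hs⟩ := key_inr_eq_inl_iff.1 h'
      left; left; right
      refine ⟨⟨j, s⟩, ?_⟩
      simp only [hfA, sphMap, sphIncl, Sigma.map, id, hs, hy]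
    · have h' : key φ (Sum.inr ⟨i, x⟩) = Sum.inl z' := h
      obtain ⟨s, hx, hs⟩ := key_inr_eq_inl_iff.1 h'
      left; right
      refine ⟨⟨i, s⟩, ?_⟩
      simp only [comp_apply, hfA, sphMap, sphIncl, Sigma.map, id, hs, hx, Prod.swap_prod_mk]
    · by_cases hx : OnSphere x
      · have hk : key φ (Sum.inr ⟨i, x⟩) = Sum.inl (φ i (toSphere x hx)) :=
          key_inr_of_onSphere φ hx
        have h' : key φ (Sum.inr ⟨j, y⟩) = Sum.inl (φ i (toSphere x hx)) := by rw [← hk, h]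
        obtain ⟨s, hy, hs⟩ := key_inr_eq_inl_iff.1 h'
        right
        refine ⟨(⟨i, toSphere x hx⟩, ⟨j, s⟩), hs.symm, ?_⟩
        simp only [hfB, sphIncl, Sigma.map, id, hy, Prod.mk.injEq, and_true]
        rfl
      · have hk : key φ (Sum.inr ⟨i, x⟩) = Sum.inr ⟨i, x⟩ := key_inr_of_not_onSphere φ hx
        rw [hk] at h
        have := (eq_of_key_eq_inr φ h.symm).1
        left; left; left
        exact this.symm
  have hsup : Δ ∪ A ∪ A' ∪ B ⊆ R := by
    rintro ⟨p, q⟩ (((h | ⟨s, hs⟩) | ⟨s, hs⟩) | ⟨⟨s, s'⟩, hss, hs⟩)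
    · change p = q at h
      rw [hRiff, h]
    · simp only [hfA, Prod.mk.injEq] at hs
      obtain ⟨rfl, rfl⟩ := hs
      rw [hRiff, key_inl]
      exact (key_inr_eq_inl_iff.2 ⟨s.2, rfl, rfl⟩).symm
    · simp only [comp_apply, hfA, Prod.swap_prod_mk, Prod.mk.injEq] at hs
      obtain ⟨rfl, rfl⟩ := hs
      rw [hRiff, key_inl]
      exact key_inr_eq_inl_iff.2 ⟨s.2, rfl, rfl⟩
    · simp only [hfB, Prod.mk.injEq] at hs
      obtain ⟨rfl, rfl⟩ := hs
      change sphMap φ s = sphMap φ s' at hss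
      rw [hRiff]
      have e1 : key φ (Sum.inr (sphIncl s)) = Sum.inl (sphMap φ s) :=
        key_inr_eq_inl_iff.2 ⟨s.2, rfl, rfl⟩
      have e2 : key φ (Sum.inr (sphIncl s')) = Sum.inl (sphMap φ s') :=
        key_inr_eq_inl_iff.2 ⟨s'.2, rfl, rfl⟩
      rw [e1, e2, hss]
  rw [Subset.antisymm hsub hsup]
  exact ((hΔc.union hAc).union hA'c).union hBc

/-- **Attaching finitely many discs to a compact Hausdorff space gives a Hausdorff space** (the
gluing relation is closed; `t2Space_quotient_of_isClosed`).  (Hausdorffness holds without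
compactness of `Z`; only the compact case is needed and proved.) [folklore] -/
instance instT2Space [CompactSpace Z] [T2Space Z] [Finite ι] : T2Space (DiscAttach φ) := by
  haveI : CompactSpace (↥(𝔻 d)) := isCompact_iff_compactSpace.1 (isCompact_closedBall _ _)
  exact t2Space_quotient_of_isClosed (DiscAttach.setoid φ) (isClosed_rel φ)

end DiscAttach

end Literature.AlgebraicTopology.Homotopy

namespace Literature.AlgebraicTopology.Homotopy

namespace DiscAttach

/-- Local notation: the model disc and sphere. -/
local notation "𝔻 " d:arg => Metric.closedBall (0 : Fin d → ℝ) 1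
local notation "𝕊 " d:arg => Metric.sphere (0 : Fin d → ℝ) 1

variable {X : Type u} [TopologicalSpace X] {ι : Type} {d : ℕ}

/-! ### Embedded discs: a subspace with discs attached along their boundary spheres is the
attachment space -/

/-- The attaching maps of embedded discs `Φᵢ : D^d → X` meeting `Y` exactly in their boundary
spheres: the restrictions `∂D^d → Y`. [folklore] -/
def sphereRestrict (Y : Set X) (Φ : ι → C(↥(𝔻 d), X))
    (hmem : ∀ i x, Φ i x ∈ Y ↔ OnSphere x) (i : ι) : C(↥(𝕊 d), ↥Y) where
  toFun s := ⟨Φ i (ofSphere s), (hmem i _).2 (onSphere_ofSphere s)⟩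
  continuous_toFun := ((Φ i).continuous.comp (continuous_inclusion sphere_subset_closedBall)).subtype_mk _

/-- `sphereRestrict` on points. [folklore] -/
@[simp]
theorem coe_sphereRestrict (Y : Set X) (Φ : ι → C(↥(𝔻 d), X))
    (hmem : ∀ i x, Φ i x ∈ Y ↔ OnSphere x) (i : ι) (s : ↥(𝕊 d)) :
    (sphereRestrict Y Φ hmem i s : X) = Φ i (ofSphere s) := rfl

/-- The comparison map from the attachment space to the subspace `Y ∪ ⋃ᵢ Φᵢ(D^d)`. [folklore] -/
def toUnion (Y : Set X) (Φ : ι → C(↥(𝔻 d), X)) (hmem : ∀ i x, Φ i x ∈ Y ↔ OnSphere x) :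
    C(DiscAttach (sphereRestrict Y Φ hmem), ↥(Y ∪ ⋃ i, range (Φ i))) :=
  desc (sphereRestrict Y Φ hmem)
    ⟨fun y => ⟨y, Or.inl y.2⟩, continuous_subtype_val.subtype_mk _⟩
    (fun i => ⟨fun x => ⟨Φ i x, Or.inr (mem_iUnion.2 ⟨i, x, rfl⟩)⟩,
      (Φ i).continuous.subtype_mk _⟩)
    (fun _ _ => Subtype.ext rfl)

/-- `toUnion` on `Y`. [folklore] -/
@[simp]
theorem coe_toUnion_inZ (Y : Set X) (Φ : ι → C(↥(𝔻 d), X))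
    (hmem : ∀ i x, Φ i x ∈ Y ↔ OnSphere x) (y : ↥Y) :
    (toUnion Y Φ hmem (inZ _ y) : X) = y := rfl

/-- `toUnion` on the discs. [folklore] -/
@[simp]
theorem coe_toUnion_inD (Y : Set X) (Φ : ι → C(↥(𝔻 d), X))
    (hmem : ∀ i x, Φ i x ∈ Y ↔ OnSphere x) (i : ι) (x : ↥(𝔻 d)) :
    (toUnion Y Φ hmem (inD _ i x) : X) = Φ i x := rfl

/-- The comparison map is a bijection when the discs are embedded and pairwise disjoint.
[folklore] -/
theorem bijective_toUnion (Y : Set X) (Φ : ι → C(↥(𝔻 d), X))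
    (hmem : ∀ i x, Φ i x ∈ Y ↔ OnSphere x) (hinj : ∀ i, Injective (Φ i))
    (hdisj : Pairwise fun i j => Disjoint (range (Φ i)) (range (Φ j))) :
    Bijective (toUnion Y Φ hmem) := by
  refine ⟨fun m m' h => ?_, fun p => ?_⟩
  · have hX : (toUnion Y Φ hmem m : X) = toUnion Y Φ hmem m' := congrArg Subtype.val h
    rcases exists_eq (sphereRestrict Y Φ hmem) m with ⟨z, rfl⟩ | ⟨i, x, hx, rfl⟩ <;>
      rcases exists_eq (sphereRestrict Y Φ hmem) m' with ⟨z', rfl⟩ | ⟨j, y, hy, rfl⟩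
    · change (z : X) = z' at hX
      rw [Subtype.ext hX]
    · change (z : X) = Φ j y at hX
      have : Φ j y ∈ Y := hX ▸ z.2
      exact absurd ((hmem j y).1 this) hy
    · change Φ i x = (z' : X) at hX
      have : Φ i x ∈ Y := hX.symm ▸ z'.2
      exact absurd ((hmem i x).1 this) hx
    · change Φ i x = Φ j y at hX
      by_cases hij : i = j
      · subst hij
        rw [hinj i hX]
      · exact absurd hX fun h => Set.disjoint_left.1 (hdisj hij) ⟨x, rfl⟩ ⟨y, h.symm⟩
  · rcases p with ⟨p, hp | hp⟩
    · exact ⟨inZ _ ⟨p, hp⟩, Subtype.ext rfl⟩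
    · obtain ⟨i, x, rfl⟩ := mem_iUnion.1 hp |>.imp fun i hi => mem_range.1 hi
      exact ⟨inD _ i x, Subtype.ext rfl⟩

/-- **A subspace with embedded discs attached along their boundary spheres is the attachment
space.**  Let `X` be Hausdorff, `Y ⊆ X` compact, and `Φᵢ : D^d → X` (finitely many) continuous
injections with `Φᵢ x ∈ Y ↔ ‖x‖ = 1` and pairwise disjoint images.  Then `Y ∪ ⋃ᵢ Φᵢ(D^d)` is
homeomorphic to `Y ∪_φ ⊔ᵢ D^d`, `φᵢ = Φᵢ|∂D^d` (a continuous bijection from a compact space to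
a Hausdorff one).  This is the situation of Milnor's `V ∪ D₁ ∪ ⋯ ∪ D_k` (1965, Remark after
Thm. 3.14: the left-hand discs are disjoint embedded discs meeting the level `V` in their boundary
spheres). [folklore] -/
def homeomorphUnion [T2Space X] [Finite ι] (Y : Set X) (hY : IsCompact Y) (Φ : ι → C(↥(𝔻 d), X))
    (hmem : ∀ i x, Φ i x ∈ Y ↔ OnSphere x) (hinj : ∀ i, Injective (Φ i))
    (hdisj : Pairwise fun i j => Disjoint (range (Φ i)) (range (Φ j))) :
    DiscAttach (sphereRestrict Y Φ hmem) ≃ₜ ↥(Y ∪ ⋃ i, range (Φ i)) :=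
  haveI : CompactSpace ↥Y := isCompact_iff_compactSpace.1 hY
  Continuous.homeoOfEquivCompactToT2
    (f := Equiv.ofBijective _ (bijective_toUnion Y Φ hmem hinj hdisj)) (toUnion Y Φ hmem).continuous

/-- `homeomorphUnion` on `Y`. [folklore] -/
@[simp]
theorem coe_homeomorphUnion_inZ [T2Space X] [Finite ι] (Y : Set X) (hY : IsCompact Y)
    (Φ : ι → C(↥(𝔻 d), X)) (hmem : ∀ i x, Φ i x ∈ Y ↔ OnSphere x) (hinj : ∀ i, Injective (Φ i))
    (hdisj : Pairwise fun i j => Disjoint (range (Φ i)) (range (Φ j))) (y : ↥Y) :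
    (homeomorphUnion Y hY Φ hmem hinj hdisj (inZ _ y) : X) = y := rfl

/-- `homeomorphUnion` on the discs. [folklore] -/
@[simp]
theorem coe_homeomorphUnion_inD [T2Space X] [Finite ι] (Y : Set X) (hY : IsCompact Y)
    (Φ : ι → C(↥(𝔻 d), X)) (hmem : ∀ i x, Φ i x ∈ Y ↔ OnSphere x) (hinj : ∀ i, Injective (Φ i))
    (hdisj : Pairwise fun i j => Disjoint (range (Φ i)) (range (Φ j))) (i : ι) (x : ↥(𝔻 d)) :
    (homeomorphUnion Y hY Φ hmem hinj hdisj (inD _ i x) : X) = Φ i x := rfl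

end DiscAttach

end Literature.AlgebraicTopology.Homotopy
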